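import Summits.ResolutionOfSingularities.ResolutionOfSingularities.Theorems.FrobeniusLadderFRationalResolutionChartHloc
import Summits.ResolutionOfSingularities.ResolutionOfSingularities.Theorems.FrobeniusLadderFRationalResolutionCentreDescent
import Summits.ResolutionOfSingularities.ResolutionOfSingularities.Theorems.FrobeniusLadderFRationalResolutionFibreReduced
import Summits.ResolutionOfSingularities.ResolutionOfSingularities.Theorems.FrobeniusLadderFRationalResolutionIsolatedGlue
import Mathlib.RingTheory.Flat.Localization
import Mathlib.RingTheory.Localization.Away.AdjoinRoot
import HarnessLib

/-!
# Crux `FrobeniusLadder.FRationalResolution` (stmt-ResolutionOfSingularities-15317), line `redirect`,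
# stub `stub_diagonalizableQuotientResolution` — isolated singularities resolved étale-locally by the blow-up of an
# arbitrary `𝔪`-PRIMARY centre, TRIVIAL residue extension (T3, full assembly)

Companion of `…PointBlowupEtale.lean` (centre = the point, no residue condition). Here the chart-side centre is ANY
`𝔔`-primary `J` (`𝔔ᵏ ⊆ J ⊆ 𝔔`, e.g. the monomial `𝔪`-primary ideal of a strong toric resolution, brick T1) with
`Bl_J(Spec C)` regular; the price is a TRIVIAL residue field extension at the chart point (so that `J` descends,
`…CentreDescent.exists_descended_centre`). Chain: `…FibreReduced` (unramified ⇒ reduced fibre on `D(g)`) →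
`…CentreDescent` (descended `𝔭`-primary `I` with `I C_g = J C_g`) → `…ChartHloc.hloc_of_flat_chart` (fpqc descent of the
regular blow-up, cone-model packaging) → `…IsolatedGlue`.

* `hloc_of_primaryBlowup_flat_chart`, **`hasResolution_of_primaryBlowup_flat_charts`**.

Honest label: assembly (no stub closed by name). No definitions, no named facts, no sorry.
[folklore; cite: Kollar2007, §2.2; StacksProject, Tag 00UW]
-/

noncomputable section

-- single-problem summit: the doubled namespace component is forced
set_option linter.dupNamespace false

open CategoryTheory AlgebraicGeometry TopologicalSpace
open Literature.AlgebraicGeometry.Resolution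

namespace Summit.ResolutionOfSingularities.ResolutionOfSingularities.Theorems.FRationalResolution.PrimaryCentreEtale

/-- **`hloc` at an isolated singular point from a flat chart, unramified with TRIVIAL residue extension at the point,
carrying a regular blow-up of a `𝔔`-primary centre.** Data: `ι : Spec B → X` affine open over `k` (`B` a domain of
finite type over `k`), `𝔭 ⊆ B` maximal `≠ 0` with `ι 𝔭` singular and all other points of `Spec B` regular; `C` a flat
finitely presented `B`-algebra, `𝔔` maximal over `𝔭` with `𝔭 C_𝔔 = 𝔪_{C_𝔔}` and every element of `C` congruent mod
`𝔔` to an element of `B`; `J` with `𝔔ᵏ ⊆ J ⊆ 𝔔` and `Bl_J(Spec C)` regular. [cite: Kollar2007, §2.2] -/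
theorem hloc_of_primaryBlowup_flat_chart (k : Type) [Field k] (X : Scheme.{0}) [IsIntegral X]
    (f : X ⟶ Spec (.of k)) [LocallyOfFiniteType f]
    {B C : Type} [CommRing B] [CommRing C] [Algebra B C] [IsDomain B] [Algebra k B] [Algebra.FiniteType k B]
    [Module.Flat B C] [Algebra.FinitePresentation B C]
    (ι : Spec (.of B) ⟶ X) [IsOpenImmersion ι] (hι : ι ≫ f = Spec.map (CommRingCat.ofHom (algebraMap k B)))
    (𝔭 : Ideal B) [h𝔭 : 𝔭.IsMaximal] (h𝔭0 : 𝔭 ≠ ⊥)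
    (hsing : ι ⟨𝔭, h𝔭.isPrime⟩ ∉ Scheme.regularLocus X)
    (hregB : ∀ P : Spec (.of B), P.asIdeal ≠ 𝔭 → P ∈ Scheme.regularLocus (Spec (.of B)))
    (𝔔 : Ideal C) [h𝔔 : 𝔔.IsMaximal] (hover : 𝔭 ≤ 𝔔.comap (algebraMap B C))
    (hres : ∀ c : C, ∃ b : B, c - algebraMap B C b ∈ 𝔔)
    (hunr : 𝔭.map (algebraMap B (Localization.AtPrime 𝔔)) =
      IsLocalRing.maximalIdeal (Localization.AtPrime 𝔔))
    (J : Ideal C) {n : ℕ} (hJ : 𝔔 ^ n ≤ J) (hJ𝔔 : J ≤ 𝔔) (hregJ : Scheme.IsRegular (affineBlowup J)) :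
    ∃ (V : X.Opens), ι ⟨𝔭, h𝔭.isPrime⟩ ∈ V ∧
      (∀ t : X, t ∉ Scheme.regularLocus X → t ∈ V → t = ι ⟨𝔭, h𝔭.isPrime⟩) ∧
      ∃ (Y : Scheme.{0}) (ρ : Y ⟶ V), IsProper ρ ∧ Scheme.IsRegular Y ∧
        IsIso (ρ ∣_ (V.ι ⁻¹ᵁ ⟨Scheme.regularLocus X, isOpen_regularLocus_of_locallyOfFiniteType_field f⟩)) ∧
        Dense ((ρ ⁻¹ᵁ (V.ι ⁻¹ᵁ ⟨Scheme.regularLocus X,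
          isOpen_regularLocus_of_locallyOfFiniteType_field f⟩) : Y.Opens) : Set Y) := by
  haveI : IsNoetherianRing B := Algebra.FiniteType.isNoetherianRing k B
  haveI : IsNoetherianRing C := Algebra.FiniteType.isNoetherianRing B C
  -- over `D(g)` the fibre of `𝔭` is the reduced point `𝔔`
  obtain ⟨g, hg, hle⟩ := FibreReduced.exists_away_fibre_reduced 𝔭 𝔔 hunr
  haveI : Algebra.FinitePresentation B (Localization.Away g) :=
    haveI := IsLocalization.Away.finitePresentation g (S := Localization.Away g)
    Algebra.FinitePresentation.trans B C (Localization.Away g)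
  haveI : IsOpenImmersion (Spec.map (CommRingCat.ofHom (algebraMap C (Localization.Away g)))) :=
    IsOpenImmersion.of_isLocalization g
  have halg : algebraMap B (Localization.Away g) =
      (algebraMap C (Localization.Away g)).comp (algebraMap B C) := IsScalarTower.algebraMap_eq B C _
  -- descend the centre
  obtain ⟨I, hpI, hIp, hIJ⟩ :=
    CentreDescent.exists_descended_centre 𝔭 𝔔 hover hres g hg (Localization.Away g) hle J hJ hJ𝔔
  -- `Bl_{I C_g} = Bl_{J C_g}` is an open piece of `Bl_J`
  have hregC : Scheme.IsRegular (affineBlowup (I.map (algebraMap B (Localization.Away g)))) := by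
    rw [halg, hIJ]
    exact BlowupFlatCriteria.isRegular_affineBlowup_map_of_isOpenImmersion _ J hregJ
  -- `𝔭` lies under `𝔔 C_g`
  have hdisj : Disjoint ((Submonoid.powers g : Submonoid C) : Set C) (𝔔 : Set C) := by
    refine Set.disjoint_left.mpr ?_
    rintro x ⟨m, rfl⟩ hx
    exact hg (h𝔔.isPrime.mem_of_pow_mem m hx)
  haveI hQ'prime : (𝔔.map (algebraMap C (Localization.Away g))).IsPrime :=
    IsLocalization.isPrime_of_isPrime_disjoint (Submonoid.powers g) _ 𝔔 h𝔔.isPrime hdisj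
  have hcomapQ : 𝔔.comap (algebraMap B C) = 𝔭 :=
    (h𝔭.eq_of_le (Ideal.IsPrime.ne_top inferInstance) hover).symm
  have h𝔭C : (⟨𝔭, h𝔭.isPrime⟩ : PrimeSpectrum B) ∈
      Set.range (PrimeSpectrum.comap (algebraMap B (Localization.Away g))) := by
    have hQQ : (𝔔.map (algebraMap C (Localization.Away g))).comap (algebraMap C (Localization.Away g)) = 𝔔 :=
      IsLocalization.under_map_of_isPrime_disjoint (Submonoid.powers g) (Localization.Away g) h𝔔.isPrime hdisj
    refine ⟨⟨𝔔.map (algebraMap C (Localization.Away g)), hQ'prime⟩, ?_⟩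
    ext1
    change (𝔔.map (algebraMap C (Localization.Away g))).comap (algebraMap B (Localization.Away g)) = 𝔭
    rw [halg, ← Ideal.comap_comap, hQQ]
    exact hcomapQ
  have hsingB : (⟨𝔭, h𝔭.isPrime⟩ : Spec (.of B)) ∉ Scheme.regularLocus (Spec (.of B)) :=
    fun hreg => hsing ((mem_regularLocus_iff_of_flat_of_isPreimmersion ι _).mp hreg)
  -- `I ≠ 0` (it contains `𝔭ⁿ`, `B` a domain)
  have hI0 : I ≠ ⊥ := by
    intro h0
    have : 𝔭 ^ n = ⊥ := le_bot_iff.mp (h0 ▸ hpI)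
    exact pow_ne_zero n h𝔭0 this
  exact ChartHloc.hloc_of_flat_chart k X f (C := Localization.Away g) ι hι 𝔭 I (IsNoetherian.noetherian I) hI0
    hpI hIp h𝔭C hregC hsingB hregB

/-- **RESOLUTION OF ISOLATED SINGULARITIES RESOLVED ÉTALE-LOCALLY, WITH TRIVIAL RESIDUE EXTENSION, BY AN `𝔪`-PRIMARY
BLOW-UP.** Let `X` be an integral `k`-scheme locally of finite type with finitely many singular points, each the image
`ι 𝔭` of a maximal ideal `≠ 0` of an affine open `Spec B ↪ X` (`Spec B ∖ {𝔭}` regular) carrying a flat finitely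
presented `B`-algebra `C` with a maximal `𝔔` over `𝔭`, unramified with trivial residue extension there, and a
`𝔔`-primary `J` with `Bl_J(Spec C)` regular. Then `X` has a resolution of singularities. [cite: Kollar2007, §2.2] -/
theorem hasResolution_of_primaryBlowup_flat_charts (k : Type) [Field k] (X : Scheme.{0}) [IsIntegral X]
    (f : X ⟶ Spec (.of k)) [LocallyOfFiniteType f] (hfin : (Scheme.regularLocus X)ᶜ.Finite)
    (hchart : ∀ s : X, s ∉ Scheme.regularLocus X →
      ∃ (B C : Type) (_ : CommRing B) (_ : CommRing C) (_ : Algebra B C) (_ : IsDomain B) (_ : Algebra k B)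
        (_ : Algebra.FiniteType k B) (_ : Module.Flat B C) (_ : Algebra.FinitePresentation B C)
        (ι : Spec (.of B) ⟶ X) (_ : IsOpenImmersion ι)
        (_ : ι ≫ f = Spec.map (CommRingCat.ofHom (algebraMap k B)))
        (𝔭 : Ideal B) (h𝔭 : 𝔭.IsMaximal) (_ : 𝔭 ≠ ⊥) (_ : ι ⟨𝔭, h𝔭.isPrime⟩ = s)
        (_ : ∀ P : Spec (.of B), P.asIdeal ≠ 𝔭 → P ∈ Scheme.regularLocus (Spec (.of B)))
        (𝔔 : Ideal C) (_ : 𝔔.IsMaximal) (J : Ideal C) (n : ℕ), 𝔭 ≤ 𝔔.comap (algebraMap B C) ∧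
          (∀ c : C, ∃ b : B, c - algebraMap B C b ∈ 𝔔) ∧
          𝔭.map (algebraMap B (Localization.AtPrime 𝔔)) =
            IsLocalRing.maximalIdeal (Localization.AtPrime 𝔔) ∧
          𝔔 ^ n ≤ J ∧ J ≤ 𝔔 ∧ Scheme.IsRegular (affineBlowup J)) :
    Scheme.HasResolution X := by
  refine IsolatedGlue.hasResolution_of_finite_singularLocus_of_local k X f hfin fun s hs => ?_
  obtain ⟨B, C, _, _, _, _, _, _, _, _, ι, _, hι, 𝔭, h𝔭, h𝔭0, hιs, hregB, 𝔔, _, J, n, hover, hres, hunr, hJ, hJ𝔔,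
    hregJ⟩ := hchart s hs
  subst hιs
  exact hloc_of_primaryBlowup_flat_chart k X f ι hι 𝔭 h𝔭0 hs hregB 𝔔 hover hres hunr J hJ hJ𝔔 hregJ

end Summit.ResolutionOfSingularities.ResolutionOfSingularities.Theorems.FRationalResolution.PrimaryCentreEtale

end
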